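import Summits.ABC.ABC.Theses.CubicResolventAllowance
import Summits.ABC.StrongHypotheses
import Summits.ABC.FunctionField.TransferSheet
import Literature.NumberTheory.EllipticCurves.SzpiroOfAbcProofs

/-!
# Stub ideation k=1 for `stub_realCubic` (family 1: recognise & import), rev 4 / gen 4 —
# the ON-PATH REGISTRY SWEEP: every registered strong hypothesis of the summit implies the stub.

Crux `IndexSzpiro` (stmt-ABC-22740), route `CubicResolventAllowance`; companion plan
`STUB-IDEAS-stub_realCubic-1.md` (rev 4).  Earlier k1 files are NOT superseded and not repeated:
`StubIdeas1RealSketch.lean` (rev 2: Plans A/B/C, 4 sorried helpers A2 A4 B1 B2),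
`StubIdeas1RealSketchG3.lean` (rev 3: sorry-free on-path / window / prime-conductor certificates).

This file is `sorry`-FREE and self-contained (imports only tree modules).  It records, in kernel form,
the gen-4 family-1 TREE MATCH: the strong-hypothesis registry of the summit
(`Summits/ABC/StrongHypotheses.lean`, D-0034: `UniformABCConjecture`, `GeneralizedSzpiroConjectureBG`,
`ModifiedSzpiroConjecture`, `StrongHallConjecture`, `ABCQualityForm`, `BakerExplicitABC`,
`RSTConjectureAUpper`) and the transfer-sheet requirement `Summit.ABC.FunctionField.RKS` each imply
`stub_realCubic` BY NAME, through `ABC → IndexSzpiro` (Silverman VIII.11.5(b) = tree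
`szpiro_of_abcLe_holds`) resp. `RKS → SzpiroConjecture` (tree `szpiro_of_rks`).  In particular the
hypothesis in which the allowance `|d_K|` is NATIVE — Granville–Stark's uniform abc over number fields
(`UniformABCConjecture`, abc.S21; von Känel, IMRN 2014 = arXiv:1310.7980, Thm 3.5 (iii): Masser's (abc)
in degree `≤ 6` gives Szpiro `6 + ε` over `ℚ` THROUGH the 2-division field `ℚ(E[2])`, Prop. 4.2) —
reaches the stub only through full abc: no registered hypothesis strictly between Szpiro and the stub
exists in the tree.  Typed ≠ proved; nothing here is progress on abc or Szpiro.
-/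

set_option linter.dupNamespace false

noncomputable section

namespace Summit.ABC.ABC.Cruxes.IndexSzpiro.StubIdeas1RealG4

open Summit.ABC.ABC.Theses.CubicResolventAllowance
open Literature.NumberTheory.EllipticCurves Literature.NumberTheory.DiophantineGeometry
open Literature.Barriers.ABC
open Literature.Abc

/-! ## §0 The registered stub, verbatim, as a Prop (same normalised signature as rev 2/3, k2, k3) -/

/-- `stub_realCubic` (the `d_K > 0` half of `IndexSzpiro`), verbatim registered signature. -/
def StubRealCubic : Prop :=
  ∀ ε : ℝ, 0 < ε → ∃ C : ℝ, ∀ (W : WeierstrassCurve ℚ) [W.IsElliptic] (K : Type) [Field K]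
    [NumberField K], Irreducible W.twoTorsionPolynomial.toPoly → Module.finrank ℚ K = 3 →
    (∃ θ : K, Polynomial.aeval θ W.twoTorsionPolynomial.toPoly = 0) → 0 < NumberField.discr K →
    (W.minimalDiscriminantNorm ℤ : ℝ) ≤
      C * |(NumberField.discr K : ℝ)| * (W.conductorNorm ℤ : ℝ) ^ (6 + ε)

/-- `1 ≤ |d_K|` as reals. -/
theorem one_le_abs_discr (K : Type) [Field K] [NumberField K] :
    (1 : ℝ) ≤ |(NumberField.discr K : ℝ)| := by
  have h1 : (1 : ℤ) ≤ |NumberField.discr K| := Int.one_le_abs (NumberField.discr_ne_zero K)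
  have h2 : ((1 : ℤ) : ℝ) ≤ ((|NumberField.discr K| : ℤ) : ℝ) := by exact_mod_cast h1
  simpa [Int.cast_abs] using h2

/-! ## §1 The two on-path lemmas of rev 3 (re-proved here so that this file stands alone) -/

/-- The crux gives its real half. -/
theorem stubRealCubic_of_indexSzpiro (h : IndexSzpiro) : StubRealCubic := by
  intro ε hε
  obtain ⟨C, hC⟩ := h ε hε
  exact ⟨C, fun W _ K _ _ hirr hdeg hθ _ => hC W K hirr hdeg hθ⟩

/-- `SzpiroConjecture → IndexSzpiro` (both signs; `K` enters only through `1 ≤ |d_K|`). -/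
theorem indexSzpiro_of_szpiro (h : SzpiroConjecture) : IndexSzpiro := by
  intro ε hε
  obtain ⟨C, hC⟩ := h ε hε
  refine ⟨max C 0, ?_⟩
  intro W _ K _ _ _ _ _
  have h1 := hC W
  have hd := one_le_abs_discr K
  have hrpow : (0 : ℝ) ≤ (W.conductorNorm ℤ : ℝ) ^ (6 + ε) := Real.rpow_nonneg (Nat.cast_nonneg _) _
  calc (W.minimalDiscriminantNorm ℤ : ℝ) ≤ C * (W.conductorNorm ℤ : ℝ) ^ (6 + ε) := h1
    _ ≤ max C 0 * (W.conductorNorm ℤ : ℝ) ^ (6 + ε) := mul_le_mul_of_nonneg_right (le_max_left _ _) hrpow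
    _ = max C 0 * 1 * (W.conductorNorm ℤ : ℝ) ^ (6 + ε) := by ring
    _ ≤ max C 0 * |(NumberField.discr K : ℝ)| * (W.conductorNorm ℤ : ℝ) ^ (6 + ε) :=
        mul_le_mul_of_nonneg_right (mul_le_mul_of_nonneg_left hd (le_max_right _ _)) hrpow

/-- `SzpiroConjecture → stub_realCubic`. -/
theorem stubRealCubic_of_szpiro (h : SzpiroConjecture) : StubRealCubic :=
  stubRealCubic_of_indexSzpiro (indexSzpiro_of_szpiro h)

/-- `ABC → IndexSzpiro` (tree `szpiro_of_abcLe_holds`, via the `≤`-form `abc_iff_abcLe` of the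
strong-hypothesis file). -/
theorem indexSzpiro_of_abc (h : _root_.ABC) : IndexSzpiro :=
  indexSzpiro_of_szpiro (szpiro_of_abcLe_holds (Summit.ABC.StrongHypotheses.abc_iff_abcLe.mp h))

/-- `ABC → stub_realCubic`. -/
theorem stubRealCubic_of_abc (h : _root_.ABC) : StubRealCubic :=
  stubRealCubic_of_indexSzpiro (indexSzpiro_of_abc h)

/-! ## §2 REGISTRY SWEEP (gen 4): every registered strong hypothesis / equivalent criterion of the
summit (`Summits/ABC/StrongHypotheses.lean`, census rows 1–7) and the transfer-sheet requirement `RKS`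
imply the stub, by name.  The direction is the benign one (the stub is a CONSEQUENCE of each); none of
these is known to follow from the stub. -/

/-- Row 6 — Granville–Stark's UNIFORM ABC OVER NUMBER FIELDS (the hypothesis in which a discriminant
allowance is native) `→ stub_realCubic`.  [von Känel 2014 Thm 3.5(iii) is the printed 2-division-field
version of the middle step; here the path is `uniformABC_imp_abc` (`K = ℚ`) then Silverman VIII.11.5(b).] -/
theorem stubRealCubic_of_uniformABC (h : UniformABCConjecture) : StubRealCubic :=
  stubRealCubic_of_abc (Summit.ABC.StrongHypotheses.uniformABC_imp_abc h)

/-- Row 3 — Bombieri–Gubler's generalized Szpiro conjecture (12.5.11) `→ stub_realCubic`. -/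
theorem stubRealCubic_of_generalizedSzpiroBG (h : GeneralizedSzpiroConjectureBG) : StubRealCubic :=
  stubRealCubic_of_abc (Summit.ABC.StrongHypotheses.generalizedSzpiroBG_iff_abc.mp h)

/-- Row 2 — Oesterlé's modified Szpiro conjecture `→ stub_realCubic`. -/
theorem stubRealCubic_of_modifiedSzpiro (h : ModifiedSzpiroConjecture) : StubRealCubic :=
  stubRealCubic_of_abc (Summit.ABC.StrongHypotheses.modifiedSzpiro_iff_abc.mp h)

/-- Row 4 — the strong Hall conjecture `→ stub_realCubic`. -/
theorem stubRealCubic_of_strongHall (h : StrongHallConjecture) : StubRealCubic :=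
  stubRealCubic_of_abc (Summit.ABC.StrongHypotheses.strongHall_iff_abc.mp h)

/-- Row 1 — the quality (finiteness) form of abc `→ stub_realCubic`. -/
theorem stubRealCubic_of_abcQualityForm (h : ABCQualityForm) : StubRealCubic :=
  stubRealCubic_of_abc (Summit.ABC.StrongHypotheses.abcQualityForm_iff_abc.mp h)

/-- Row 5 — Baker's explicit abc conjecture `→ stub_realCubic`. -/
theorem stubRealCubic_of_bakerExplicitABC (h : BakerExplicitABC) : StubRealCubic :=
  stubRealCubic_of_abc (Summit.ABC.StrongHypotheses.bakerExplicitABC_imp_abc h)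

/-- Row 7 — Robert–Stewart–Tenenbaum Conjecture A (upper half) `→ stub_realCubic`. -/
theorem stubRealCubic_of_rstConjectureAUpper (h : RSTConjectureAUpper) : StubRealCubic :=
  stubRealCubic_of_abc (Summit.ABC.StrongHypotheses.rstConjectureAUpper_imp_abc h)

/-- Transfer sheet, row CF-1 — the arithmetic Kodaira–Spencer requirement `R_KS` (Szpiro for the
Faltings height) `→ stub_realCubic`, through `szpiro_of_rks`. -/
theorem stubRealCubic_of_rks (h : Summit.ABC.FunctionField.RKS) : StubRealCubic :=
  stubRealCubic_of_szpiro (Summit.ABC.FunctionField.szpiro_of_rks h)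

/-! ## §3 Audit examples: the sweep composes (no new mathematics). -/

example : UniformABCConjecture → IndexSzpiro :=
  fun h => indexSzpiro_of_abc (Summit.ABC.StrongHypotheses.uniformABC_imp_abc h)

example : Summit.ABC.FunctionField.RKS → IndexSzpiro :=
  fun h => indexSzpiro_of_szpiro (Summit.ABC.FunctionField.szpiro_of_rks h)

end Summit.ABC.ABC.Cruxes.IndexSzpiro.StubIdeas1RealG4
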